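import Summits.CriticalPhenomena.CardyFormulaZ2.Theses.CardySelfRefinement
import Literature.Probability.RandomPlanarGeometry.SLEUniquenessInLaw

/-!
# COMPLETE (sorry-free) version of the skeleton line `uniqueness-subsequence-principle`
# for crux `SubseqUpgrade` (stmt-CriticalPhenomena-10279)

Landing candidate (planner `cruxplan-stmt-CriticalPhenomena-10279-uniqueness-subsequen`,
2026-08-16): the two registered stubs of `Cruxes/SubseqUpgrade/Lines/uniqueness-subsequence-principle.lean`
with the SAME names and signatures — `stub_seqCriterion : SeqCriterion`,
`stub_uniqueLawIntegral : UniqueLawIntegral` — here PROVED, the model-free transfer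
`convergesInLawToSLE_of_forall_pos_seq` fed with them, and the hypothesis-free theorem
`subseqUpgrade_holds : …Theses.CardySelfRefinement.SubseqUpgrade`. `lean check`: rc 0, 0 sorries,
0 warnings, axioms of `subseqUpgrade_holds` = `propext, Classical.choice, Quot.sound`, file audit
ok (proof-of-item closed:true; no vendored fact, no conditional proof). A prover may land it
verbatim as `Summits/CriticalPhenomena/CardyFormulaZ2/Theorems/CardySelfRefinementSubseqUpgrade.lean`
(`ledger propose --workitem stmt-CriticalPhenomena-10279`; the namespace may be kept or renamed to
`Summit.CriticalPhenomena.CardyFormulaZ2.Theorems`), or first land the two stubs with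
`--supports stmt-CriticalPhenomena-10279` (they match the registered name + signature) and then this file.

Route `CardySelfRefinement`, sub-problem `CardyFormulaZ2`. Mathematically identical to the five
kernel-checked proofs already attached to the item (refuter `Proof.lean` = `Disproof.lean`
§Positive, `SketchIdeator1/2/3(G2).lean`); this copy only aligns the decomposition with the
registered stubs. Billingsley (1999), Thm 2.6; Lawler (2005), §6.1, §6.3.
-/

open Filter Topology MeasureTheory
open scoped NNReal BoundedContinuousFunction

namespace Summit.CriticalPhenomena.CardyFormulaZ2.Cruxes.SubseqUpgrade.UniquenessSubsequencePrinciple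

open Literature.Probability.RandomPlanarGeometry

/-! ### The two statements of the line -/

/-- **S1 — the subsequence criterion along the mesh filter `𝓝[>] 0`, positivity-guarded.**
A real function `x` of the mesh tends to `L` along `𝓝[>] 0` as soon as along every
EVERYWHERE-POSITIVE sequence of meshes `s n → 0` some strictly increasing subsequence `φ` gives
`x (s (φ n)) → L`. Billingsley (1999), Thm 2.6 (real-valued case); Mathlib
`Filter.tendsto_of_subseq_tendsto` plus a positivity repair. -/
def SeqCriterion : Prop :=
  ∀ (x : ℝ → ℝ) (L : ℝ),
    (∀ s : ℕ → ℝ, (∀ n, 0 < s n) → Tendsto s atTop (𝓝 0) →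
        ∃ φ : ℕ → ℕ, StrictMono φ ∧ Tendsto (fun n => x (s (φ n))) atTop (𝓝 L)) →
      Tendsto x (𝓝[>] (0 : ℝ)) (𝓝 L)

/-- **S2 — uniqueness in law of chordal SLE_κ in a Dobrushin domain, portmanteau form.** If `μ`
is a chordal SLE_κ law of `(D; a, b)` and `Γ` a chordal SLE_κ random curve in `D`, then `μ`
integrates every bounded continuous test function exactly like the law of `Γ`.
Lawler (2005), §6.1/§6.3; in tree `IsSLELaw.eq_map_of_isSLECurve` + `integral_map`. -/
def UniqueLawIntegral : Prop :=
  ∀ (κ : ℝ≥0) (D : DobrushinDomain) (μ : Measure (CurveClass ℂ)) (Γ : (ℝ≥0 → ℝ) → CurveClass ℂ),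
    IsSLELaw κ D μ → IsSLECurve κ D Γ →
      ∀ f : CurveClass ℂ →ᵇ ℝ,
        ∫ x, f x ∂μ = ∫ ω, f (Γ ω) ∂Literature.Probability.Process.preWienerMeasure

/-! ### The two stubs, proved (same names and signatures as registered on the crux) -/

/-- **S1 holds.** `Filter.tendsto_of_subseq_tendsto` on the countably generated filter `𝓝[>] 0`;
a sequence tending to `𝓝[>] 0` is only eventually positive, so patch the finitely many
non-positive values by `1` before applying the hypothesis, and transport the eventual equality
along the strictly increasing `φ` (`StrictMono.tendsto_atTop`). Billingsley (1999), Thm 2.6. -/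
theorem stub_seqCriterion : SeqCriterion := by
  intro x L h
  classical
  refine tendsto_of_subseq_tendsto fun s hs => ?_
  obtain ⟨hs0, hpos⟩ := tendsto_nhdsWithin_iff.1 hs
  -- positivity repair at finitely many indices
  set s' : ℕ → ℝ := fun n => if 0 < s n then s n else 1 with hs'
  have hs'eq : ∀ᶠ n in atTop, s' n = s n := hpos.mono fun n hn => if_pos hn
  have hs'pos : ∀ n, 0 < s' n := fun n => by
    by_cases hn : 0 < s n
    · simp only [hs', if_pos hn]; exact hn
    · simp only [hs', if_neg hn]; exact one_pos
  have hs'0 : Tendsto s' atTop (𝓝 0) := hs0.congr' (hs'eq.mono fun n hn => hn.symm)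
  obtain ⟨φ, hφ, hlim⟩ := h s' hs'pos hs'0
  refine ⟨φ, hlim.congr' ?_⟩
  filter_upwards [hφ.tendsto_atTop.eventually hs'eq] with n hn
  rw [hn]

/-- **S2 holds.** Uniqueness in law of chordal SLE_κ (`IsSLELaw.eq_map_of_isSLECurve`, proved in
`SLEUniquenessInLaw.lean` from `IsSLECurve.map_eq_holds`) and `integral_map`.
Lawler (2005), §6.3. -/
theorem stub_uniqueLawIntegral : UniqueLawIntegral := by
  intro κ D μ Γ hμ hΓ f
  rw [hμ.eq_map_of_isSLECurve hΓ, integral_map hΓ.aemeasurable f.continuous.aestronglyMeasurable]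

/-! ### Transfer C⁺ (model-free, any `κ`) -/

section Transfer

variable {κ : ℝ≥0} {D : DobrushinDomain} {Ωδ : ℝ → Type*} [∀ δ, MeasurableSpace (Ωδ δ)]
  {Y : ∀ δ, Ωδ δ → CurveClass ℂ} {P : ∀ δ, Measure (Ωδ δ)}

/-- **C⁺ — convergence in law to chordal SLE_κ from subsequential identification alone**
(Literature-level sibling of `convergesInLawToSLE_of_isTightAlongMesh'`, "tightness +
identification" replaced by "every positive null mesh sequence has a subsequence converging in
law to SOME chordal SLE_κ law of `(D; a, b)`"; no tightness, no probability instances). The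
witness `Γ` is read off the harmonic mesh sequence; S2 pins every subsequential limit law to the
law of `Γ`, test function by test function; S1 concludes. Billingsley (1999), Thm 2.6;
Lawler (2005), §6.3. -/
theorem convergesInLawToSLE_of_forall_pos_seq
    (hY : ∀ᶠ δ in 𝓝[>] (0 : ℝ), AEMeasurable (Y δ) (P δ))
    (h : ∀ s : ℕ → ℝ, (∀ n, 0 < s n) → Tendsto s atTop (𝓝 0) →
      ∃ φ : ℕ → ℕ, StrictMono φ ∧ ∃ μ : Measure (CurveClass ℂ), IsSLELaw κ D μ ∧
        ∀ f : CurveClass ℂ →ᵇ ℝ,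
          Tendsto (fun n => ∫ ω, f (Y (s (φ n)) ω) ∂P (s (φ n))) atTop (𝓝 (∫ x, f x ∂μ))) :
    ConvergesInLawToSLE κ D Y P := by
  -- the witness: one SLE_κ random curve in `D`, read off the harmonic mesh sequence `1/(n+1)`
  obtain ⟨-, -, μ₀, hμ₀, -⟩ := h (fun n => 1 / ((n : ℝ) + 1)) (fun n => Nat.one_div_pos_of_nat)
    tendsto_one_div_add_atTop_nhds_zero_nat
  obtain ⟨Γ, hΓ, -⟩ := hμ₀
  refine ⟨Γ, hΓ, hY, fun f => ?_⟩
  -- S1, one bounded continuous test function at a time, the target pinned by S2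
  refine stub_seqCriterion (fun δ => ∫ ω, f (Y δ ω) ∂P δ) _ fun s hspos hs0 => ?_
  obtain ⟨φ, hφ, μ, hμ, hlim⟩ := h s hspos hs0
  refine ⟨φ, hφ, ?_⟩
  rw [← stub_uniqueLawIntegral κ D μ Γ hμ hΓ f]
  exact hlim f

end Transfer

/-! ### The crux -/

/-- **The crux `CardySelfRefinement.SubseqUpgrade` holds**: specialise clause (H2) to the pair
`(D, E)` at hand and apply `convergesInLawToSLE_of_forall_pos_seq` with `κ = 6`,
`Ωδ := fun _ => BondConfig (Site 2)`, `Y δ := bondInterfaceIn D (E δ)`,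
`P δ := bondPercolation (zdGraph 2) half`; clause (H1) is the measurability input verbatim.
Sorry-free; axioms `propext`, `Classical.choice`, `Quot.sound`. -/
theorem subseqUpgrade_holds :
    Summit.CriticalPhenomena.CardyFormulaZ2.Theses.CardySelfRefinement.SubseqUpgrade := by
  rintro ⟨hmeas, hsub⟩ D E hE
  refine convergesInLawToSLE_of_forall_pos_seq (hmeas D E hE) fun s hspos hs0 => ?_
  obtain ⟨φ, hφ, Pf, hPf, hconv⟩ := hsub s hspos hs0
  exact ⟨φ, hφ, Pf D, hPf D, fun f => hconv D E hE f⟩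

end Summit.CriticalPhenomena.CardyFormulaZ2.Cruxes.SubseqUpgrade.UniquenessSubsequencePrinciple
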